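import Summits.BirchSwinnertonDyer.BirchSwinnertonDyer.Theorems.EisensteinPrimesKatzLineDescent
import Summits.BirchSwinnertonDyer.BirchSwinnertonDyer.Theorems.EisensteinPrimesKatzLineDescentStructure
import Summits.BirchSwinnertonDyer.BirchSwinnertonDyer.Theorems.UniversalToricDescentRoadFFMemberSaturation
import Summits.BirchSwinnertonDyer.Rank1Residual.X11b.BDPFrameUniqueness
import Literature.NumberTheory.EllipticCurves.UnrIntegersUnits
import HarnessLib

/-!
# Cross-period rigidity of the CGLS Katz frame `IsKatzLFunction`, STRUCTURAL HALF: the supply along all powers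
# of one interpolation character, the value relation `L''(u^k − 1) = d^k·L(u^k − 1)` of two `R₀` frames, and the
# structural lemma `M = c·(1+T)^b·Q` read back in `R₀⟦T⟧`
# (helper file 1 of 2 for crux 2 `GoodLatticeBDPValue`, stmt-BirchSwinnertonDyer-19032, line `halves` v34N; closes no stub)

Cell `bsd-eis` (run/shared/lean/pub/bsd-eis/), width seat `bsd-line-x1-p1-w2` gen 31. THEOREMS ONLY (no definition,
no named fact, no `sorry`; imports no `Theses` module); `--supports stmt-BirchSwinnertonDyer-19032`.

WHY. Two of the seven PUBLISHED names behind the by-name closure of crux 2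
(`GoodLatticeBDPValueOfNamedFactsV34.goodLatticeBDPValue_of_namedFacts₃₄`, p763736) —
`Hida2010MuInvariant.thmI_mu_katzLFunction_eq_zero` and
`CastellaGrossiLeeSkinner2022.proofThm221_congruence_of_fullEisensteinDescent` — are phrased for EVERY `R₀` Katz frame
`IsKatzLFunction ι v v̄ Cbar κ γ θ_K Ω_K Ω_p L`, ANY periods, whereas print (Hida 2010 Thm. I; CGLS 2022 Thm. 2.2.1) speaks
of THE measure at ITS periods; their docstrings invoke frame rigidity «not asserted separately». For BDP frames the tree
has the ideal-level statement (`UniversalToricDescentTwinSplit.span_singleton_eq_of_isBDPLFunction`); for the CGLS Katz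
frame it had only the first-unit-INDEX transfer (`GoodLatticeAnacongFrames.firstUnitCoeffAt_of_isKatzLFunction_of_isKatzLFunction`,
via the `p`-power map), and the structural lemma of the ODE road (`KatzLineDescent.exists_eq_C_mul_binomialSeries_map_mul_of_relation`,
«`L = c·(1+T)^b·Q`») was applied to no frame. This file and its sequel `…KatzFrameSpanRigidity` close that gap: two Katz
frames at ANY two period pairs are `L'' = c·(1+T)^b·L`, `c ∈ R₀ˣ`, `b ∈ ℤ_p`, hence generate the SAME ideal of
`Λ^{ur} = R₀⟦T⟧`; at fixed periods they coincide; and every ideal-theoretic statement (`μ`, `λ`, identities of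
characteristic ideals, congruences modulo `𝔪` up to a unit — the conclusion shape of `proofThm221_…`) passes from ONE
frame to EVERY frame. So the `∀`-frame phrasing of those two names costs exactly one frame (kernel form of the «frame
rigidity» remark in their docstrings).

CONTENTS (`K` imaginary quadratic, `p` odd, `κ` anticyclotomic with topological generator `γ`, `θ_K` of finite order):
§1 `exists_katzSupply_pow` — CGLS data `φ_k = φ₁^{(p−1)k}` along ALL `k ≥ 1` (w4's `exists_katzSupply` runs along
`p^k` only): type `(n₁k, −n₁k)`, `p − 1 ∣ n₁`, avatars through `κ` with value `u^k`, `u` a principal unit which is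
no root of unity, Tate's entire continuation; §2 `exists_value_relation_of_isKatzLFunction` — two frames satisfy
`L''(u^k − 1) = d^k·L(u^k − 1)`, `d ≠ 0`; §3 bookkeeping (`R₀⟦T⟧ → ℂ_p⟦T⟧`, `p`-contents and values, the identity
principle along `u^{p^j} − 1 → 0`, multiples of a series with coefficients in `𝔪_{R₀}`); §4 `exists_eq_of_relation_of_firstUnitCoeffAt` — w3's structural lemma read back
in `R₀⟦T⟧` for a series with `μ = 0`, and the `(1+T)^b`-twist in `R₀⟦T⟧` (unit, constant term `1`).

HONEST FRAMING: elementary `p`-adic analysis assembled from tree theorems (multr1/x11b3 supply, w3's ODE road, w4's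
rescaling, cn100's identity principle, Tate's continuation discharge); closes no stub; the registry (halves v34N, 2
cite-only stubs) is untouched; no summit statement, no case of BSD, no theorem of CGLS / Hida / Katz is proved here;
0 cells / labels / tiers move.

References: [CastellaGrossiLeeSkinner2022] Thm. 2.1.2 (arXiv:2008.02571v2 TeX L1015–1041), Thm. 2.2.1 (L1051–L1116);
[Washington1997] §5.1, §7.1 Prop. 7.2, §7.2 Thm. 7.3; [Cassels1986] Ch. 4 Thm. 4.1, Ch. 6 §5; [deShalit1987] II.4.12
Remark (iv); [TateThesis1967] Thm. 4.4.1; [Hida2010MuInvariant] Thm. I (statement shape only).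
-/

set_option linter.dupNamespace false
set_option autoImplicit false

noncomputable section

open scoped Classical Topology

open Filter PowerSeries NumberField IsDedekindDomain Field Literature.NumberTheory.EllipticCurves
  Literature.NumberTheory.EllipticCurves.CastellaGrossiLeeSkinner2022
  Literature.NumberTheory.EllipticCurves.KellerYin2024
  Literature.NumberTheory.GaloisRepresentations Literature.NumberTheory.GaloisRepresentations.HeckeCharacter
  Summit.BirchSwinnertonDyer.Rank1Residual Summit.BirchSwinnertonDyer.Rank1Residual.X11b
  Summit.BirchSwinnertonDyer.Rank1Residual.X11b.Halves
  Summit.BirchSwinnertonDyer.Rank1Residual.X11b.LambdaSupply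
  Summit.BirchSwinnertonDyer.Rank1Residual.X11b.Three.LambdaSupply
  Summit.BirchSwinnertonDyer.BirchSwinnertonDyer.Theorems.IwasawaTwoVariable
  Summit.BirchSwinnertonDyer.BirchSwinnertonDyer.Theorems.KatzLineRigidity

namespace Summit.BirchSwinnertonDyer.BirchSwinnertonDyer.Theorems.GoodLatticeKatzFrameRigidity

variable {p : ℕ} [hp : Fact p.Prime] {K : Type} [Field K] [NumberField K]

/-! ### §1 The Katz supply along ALL powers of one interpolation character -/

/-- **CGLS data along every power `k ≥ 1`.** `K` imaginary quadratic, `p` odd, `κ` anticyclotomic with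
topological generator `γ`, `θ_K` of finite order: there are a principal unit `u ≠` root of unity and, for every
`k ≥ 1`, an everywhere unramified Hecke character `φ_k` of type `(n_k, −n_k)` with `0 < n_k`, `p − 1 ∣ n_k`,
`n_k = n₁·k`, a `p`-adic avatar `r_k` through `κ` with `r_k(γ) = u^k`, and an entire continuation of
`L(θ_K φ_k, s)` (Tate). [cite: CastellaGrossiLeeSkinner2022, Thm. 2.1.2] [cite: TateThesis1967, Thm. 4.4.1] -/
theorem exists_katzSupply_pow (hp2 : p ≠ 2) (ι : PadicAlgCl p ≃+* ℂ) (hK : IsImaginaryQuadratic K)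
    {κ : ZpExtension K p} (hκ : κ.IsAnticyclotomic) {γ : absoluteGaloisGroup K}
    (hγ : κ.IsTopGenerator γ) {θK : HeckeCharacter K} (hfin : θK.IsFiniteOrder) :
    ∃ (n₁ : ℕ) (u : ℂ_[p]) (φ : ℕ → HeckeCharacter K) (r : ℕ → FramedGaloisRep K (PadicAlgCl p) 1),
      0 < n₁ ∧ (p - 1) ∣ n₁ ∧ ‖u - 1‖ < 1 ∧ (∀ j : ℕ, u ^ p ^ j ≠ 1) ∧
      (∀ k (w : HeightOneSpectrum (𝓞 K)), (φ k).IsUnramifiedAt w) ∧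
      (∀ k, (φ k).HasInfinityType (fun _ ↦ ((n₁ * k : ℕ) : ℤ)) (fun _ ↦ -((n₁ * k : ℕ) : ℤ))) ∧
      (∀ k, IsPAdicAvatarOf ι (φ k) (r k)) ∧ (∀ k, FactorsThroughZp κ (r k)) ∧
      (∀ k, avatarValueAt (r k) γ = u ^ k) ∧
      (∀ k, 1 ≤ k → LFunction.HasEntireContinuation (heckeLFunction (θK * φ k))) := by
  have hprime : p.Prime := hp.out
  haveI : IsTotallyComplex K := hK.2
  obtain ⟨φ₁, m₁, ψ, hm₁, hunit, hunr, hinf, hav, hfac, hx1, hne⟩ :=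
    exists_unitary_interpolationCharacter hp2 ι κ hK hκ γ hγ
  set e := (FramedRep.unitsContinuousMulEquivOfUnique (Fin 1) (PadicAlgCl p) :
    (PadicAlgCl p)ˣ →ₜ* GL (Fin 1) (PadicAlgCl p)) with he
  set x := avatarValueAt (e.comp ψ) γ with hx
  have hunr' : ∀ w : HeightOneSpectrum (𝓞 K), ((p : ℕ) : 𝓞 K) ∉ w.asIdeal → φ₁.IsUnramifiedAt w :=
    fun w _ ↦ hunr w
  have hpow_inf : ∀ j : ℕ, (φ₁ ^ j).HasInfinityType (fun _ ↦ ((m₁ * j : ℕ) : ℤ))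
      (fun _ ↦ -((m₁ * j : ℕ) : ℤ)) := fun j ↦ by
    have h := LambdaSupply.HasInfinityType.pow_nat hinf j
    convert h using 2 <;> push_cast <;> ring_nf
  refine ⟨m₁ * (p - 1), x ^ (p - 1), fun k ↦ φ₁ ^ ((p - 1) * k), fun k ↦ e.comp (ψ ^ ((p - 1) * k)),
    Nat.mul_pos hm₁ (Nat.sub_pos_of_lt hprime.one_lt), Dvd.intro_left m₁ rfl,
    lt_of_le_of_lt (R1.norm_pow_sub_one_le hx1 _) hx1, fun j hj ↦ ?_,
    fun k w ↦ isUnramifiedAt_pow' (hunr w) _, fun k ↦ ?_,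
    fun k ↦ isPAdicAvatarOf_pow ι hav hunr' _,
    fun k ↦ factorsThroughZp_unitsChar_pow κ hfac _, fun k ↦ ?_, fun k hk ↦ ?_⟩
  · -- `(x^{p-1})^{p^j} = 1` would force `x^{p^j} = 1`
    have hw : ‖x ^ p ^ j - 1‖ < 1 := lt_of_le_of_lt (R1.norm_pow_sub_one_le hx1 _) hx1
    have hcop : p.Coprime (p - 1) := (Nat.coprime_self_sub_right hprime.one_le).mpr p.coprime_one_right
    have h1 : ‖(x ^ p ^ j) ^ (p - 1) - 1‖ = ‖x ^ p ^ j - 1‖ := R1.norm_pow_sub_one_of_coprime hw hcop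
    rw [← pow_mul, mul_comm, pow_mul, hj, sub_self, norm_zero] at h1
    exact hne j (sub_eq_zero.mp (norm_eq_zero.mp h1.symm))
  · have h := hpow_inf ((p - 1) * k)
    convert h using 2 <;> push_cast <;> ring_nf
  · rw [avatarValueAt_unitsChar_pow, ← pow_mul]
  · -- Tate: `θ_K φ_k` unitary, of type `(n_k, −n_k)` with `n_k ≠ 0`, not a norm twist
    have hu1 : (θK * φ₁ ^ ((p - 1) * k)).IsUnitary :=
      hfin.isUnitary.mul (CongruentShaFreeCutLambdaSupplyAnyPrime.isUnitary_pow hunit _)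
    have hinf1 : (θK * φ₁ ^ ((p - 1) * k)).HasInfinityType (fun _ ↦ ((m₁ * ((p - 1) * k) : ℕ) : ℤ))
        (fun _ ↦ -((m₁ * ((p - 1) * k) : ℕ) : ℤ)) := by
      have h := (Three.LambdaSupply.hasInfinityType_zero_of_isFiniteOrder hfin).mul' (hpow_inf ((p - 1) * k))
      convert h using 2 <;> simp
    have hn0 : ((m₁ * ((p - 1) * k) : ℕ) : ℤ) ≠ 0 := by
      have : 0 < m₁ * ((p - 1) * k) := Nat.mul_pos hm₁ (Nat.mul_pos (Nat.sub_pos_of_lt hprime.one_lt) hk)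
      exact_mod_cast this.ne'
    exact heckeLFunction_hasEntireContinuation_of_not_isNormTwist_holds _ hu1
      (not_isNormTwist_of_hasInfinityType hn0 hinf1)


/-! ### §2 The value relation of two `R₀` Katz frames along the supply -/

section Frames

variable {ι : PadicAlgCl p ≃+* ℂ} {v vbar : HeightOneSpectrum (𝓞 K)} {Cbar : Finset (HeightOneSpectrum (𝓞 K))}
  {κ : ZpExtension K p} {γ : absoluteGaloisGroup K} {θK : HeckeCharacter K}
  {ΩK ΩK'' : ℂ} {Ωp Ωp'' : ℂ_[p]} {L L'' : UnrSeries p}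

/-- The rescaling constant `c₀ = ι⁻¹((Ω_K/Ω_K'')²)·(Ω_p''/Ω_p)²` between two period pairs is non-zero.
[cite: CastellaGrossiLeeSkinner2022, Thm. 2.1.2] -/
theorem rescale_const_ne_zero (ι : PadicAlgCl p ≃+* ℂ) (hΩK : ΩK ≠ 0) (hΩK'' : ΩK'' ≠ 0) (hΩp : Ωp ≠ 0)
    (hΩp'' : Ωp'' ≠ 0) :
    ((ι.symm ((ΩK / ΩK'') ^ 2) : PadicAlgCl p) : ℂ_[p]) * (Ωp'' / Ωp) ^ 2 ≠ 0 := by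
  refine mul_ne_zero ?_ (pow_ne_zero _ (div_ne_zero hΩp'' hΩp))
  have h1 : ι.symm ((ΩK / ΩK'') ^ 2) ≠ 0 :=
    (map_ne_zero_iff ι.symm ι.symm.injective).mpr (pow_ne_zero _ (div_ne_zero hΩK hΩK''))
  simp only [PadicComplex.coe_eq]
  exact (map_ne_zero_iff _ (algebraMap (PadicAlgCl p) ℂ_[p]).injective).mpr h1

/-- **THE VALUE RELATION.** `K` imaginary quadratic, `p` odd, `κ` anticyclotomic with topological generator `γ`,
`θ_K` of finite order, all four periods non-zero: two `R₀` Katz frames `L` (periods `Ω_K, Ω_p`) and `L''`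
(periods `Ω_K'', Ω_p''`) of the same `(ι, v, v̄, Cbar, κ, γ, θ_K)` satisfy, along the powers `u^k` (`k ≥ 1`) of one
principal unit `u` which is not a root of unity, `L''(u^k − 1) = d^k · L(u^k − 1)` for one `d ≠ 0`
(`d = c₀^{n₁}`, `c₀` the period-rescaling constant). [cite: CastellaGrossiLeeSkinner2022, Thm. 2.1.2 (arXiv:2008.02571v2 TeX L1015–1041)]
[cite: Washington1997, §7.2] -/
theorem exists_value_relation_of_isKatzLFunction (hp2 : p ≠ 2) (hK : IsImaginaryQuadratic K)
    (hκ : κ.IsAnticyclotomic) (hγ : κ.IsTopGenerator γ) (hfin : θK.IsFiniteOrder)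
    (hΩK : ΩK ≠ 0) (hΩp : Ωp ≠ 0) (hΩK'' : ΩK'' ≠ 0) (hΩp'' : Ωp'' ≠ 0)
    (hL : IsKatzLFunction ι v vbar Cbar κ γ θK ΩK Ωp L)
    (hL'' : IsKatzLFunction ι v vbar Cbar κ γ θK ΩK'' Ωp'' L'') :
    ∃ (u d : ℂ_[p]), ‖u - 1‖ < 1 ∧ (∀ j : ℕ, u ^ p ^ j ≠ 1) ∧ d ≠ 0 ∧
      ∀ k : ℕ, 1 ≤ k →
        ∑' n, ((coeff n L'' : unrIntegers p) : ℂ_[p]) * (u ^ k - 1) ^ n =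
          d ^ k * ∑' n, ((coeff n L : unrIntegers p) : ℂ_[p]) * (u ^ k - 1) ^ n := by
  obtain ⟨n₁, u, φ, r, hn₁, hdvd, hu1, hune, hunr, hinf, hav, hfac, hval, hLc⟩ :=
    exists_katzSupply_pow hp2 ι hK hκ hγ hfin
  set c₀ : ℂ_[p] := ((ι.symm ((ΩK / ΩK'') ^ 2) : PadicAlgCl p) : ℂ_[p]) * (Ωp'' / Ωp) ^ 2 with hc₀
  refine ⟨u, c₀ ^ n₁, hu1, hune, pow_ne_zero _ (rescale_const_ne_zero ι hΩK hΩK'' hΩp hΩp''),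
    fun k hk ↦ ?_⟩
  have hnk : 0 < n₁ * k := Nat.mul_pos hn₁ hk
  have hdk : (p - 1) ∣ n₁ * k := Dvd.dvd.mul_right hdvd k
  have h1 := hL (φ k) (n₁ * k) hnk hdk (hunr k) (hinf k) (hLc k hk) (r k) (hav k) (hfac k)
  have h2 := hL'' (φ k) (n₁ * k) hnk hdk (hunr k) (hinf k) (hLc k hk) (r k) (hav k) (hfac k)
  rw [hval k] at h1 h2
  rw [katzFrameValue_rescale ι θK v vbar Cbar (φ k) (n₁ * k) hΩK Ωp'' hΩp, ← hc₀, pow_mul] at h2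
  rw [HasSum.tsum_eq h1, HasSum.tsum_eq h2]
  ring

end Frames


/-! ### §3 Elementary bookkeeping on `R₀⟦T⟧` read in `ℂ_p⟦T⟧` -/

section Bookkeeping

/-- Coefficients of the `ℂ_p`-image of an `R₀`-series. [folklore] -/
theorem coeff_map_subtype (L : UnrSeries p) (n : ℕ) :
    coeff n (L.map (unrIntegers p).subtype) = ((coeff n L : unrIntegers p) : ℂ_[p]) := by
  rw [coeff_map]; rfl

/-- The `ℂ_p`-image of an `R₀`-series has coefficients of norm `≤ 1`. [folklore] -/
theorem norm_coeff_map_subtype_le (L : UnrSeries p) (n : ℕ) :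
    ‖coeff n (L.map (unrIntegers p).subtype)‖ ≤ 1 := by
  rw [coeff_map_subtype]; exact norm_coe_unrIntegers_le_one p _

/-- The `(1+T)^b`-twist read in `R₀⟦T⟧` (through `toUnr : ℤ_p → R₀`) maps to the twist read in `ℂ_p⟦T⟧`
(through `ℤ_p → ℚ_p → ℂ_p`). [folklore] -/
theorem map_subtype_binomialSeries_map_toUnr (b : ℤ_[p]) :
    ((PowerSeries.binomialSeries ℤ_[p] b).map (toUnr p)).map (unrIntegers p).subtype =
      (PowerSeries.binomialSeries ℤ_[p] b).map ((algebraMap ℚ_[p] ℂ_[p]).comp PadicInt.Coe.ringHom) := by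
  have hcomp : (unrIntegers p).subtype.comp (toUnr p) = (algebraMap ℚ_[p] ℂ_[p]).comp PadicInt.Coe.ringHom := by
    ext x
    rw [RingHom.comp_apply, RingHom.comp_apply, Subring.subtype_apply, coe_toUnr]
    rfl
  rw [← hcomp, PowerSeries.map_comp, RingHom.comp_apply]

/-- `0 < ‖p‖ < 1` in `ℂ_p`. [folklore] -/
theorem norm_natCast_p_lt_one : ‖((p : ℕ) : ℂ_[p])‖ < 1 := by
  have h : ‖((p : ℕ) : ℂ_[p])‖ = ‖((p : ℕ) : ℚ_[p])‖ := by
    rw [← map_natCast (algebraMap ℚ_[p] ℂ_[p]) p, norm_algebraMap']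
  rw [h]
  exact Padic.norm_p_lt_one

/-- Coefficients of `C(p)^s · F`, `s ≥ 1`, have norm `< 1`. [folklore] -/
theorem norm_coe_coeff_C_pow_mul_lt_one {s : ℕ} (hs : 1 ≤ s) (F : UnrSeries p) (n : ℕ) :
    ‖((coeff n ((C ((p : ℕ) : unrIntegers p)) ^ s * F) : unrIntegers p) : ℂ_[p])‖ < 1 := by
  rw [← map_pow, coeff_C_mul, Subring.coe_mul, norm_mul, SubmonoidClass.coe_pow, norm_pow]
  have h1 : ‖((((p : ℕ) : unrIntegers p) : unrIntegers p) : ℂ_[p])‖ ^ s < 1 := by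
    push_cast
    exact pow_lt_one₀ (norm_nonneg _) norm_natCast_p_lt_one (by omega)
  calc ‖((((p : ℕ) : unrIntegers p) : unrIntegers p) : ℂ_[p])‖ ^ s *
        ‖((coeff n F : unrIntegers p) : ℂ_[p])‖
      ≤ ‖((((p : ℕ) : unrIntegers p) : unrIntegers p) : ℂ_[p])‖ ^ s * 1 :=
        mul_le_mul_of_nonneg_left (norm_coe_unrIntegers_le_one p _) (pow_nonneg (norm_nonneg _) _)
    _ < 1 := by rw [mul_one]; exact h1

/-- Values of `C(p)^t · F` are `p^t` times the values of `F` (as sums of the coefficient series). [folklore] -/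
theorem tsum_coeff_C_pow_mul (t : ℕ) (F : UnrSeries p) (x : ℂ_[p]) :
    ∑' n, ((coeff n ((C ((p : ℕ) : unrIntegers p)) ^ t * F) : unrIntegers p) : ℂ_[p]) * x ^ n =
      ((p : ℕ) : ℂ_[p]) ^ t * ∑' n, ((coeff n F : unrIntegers p) : ℂ_[p]) * x ^ n := by
  rw [← tsum_mul_left]
  refine tsum_congr fun n ↦ ?_
  rw [← map_pow, coeff_C_mul, Subring.coe_mul, SubmonoidClass.coe_pow]
  push_cast
  ring

/-- A series with a unit coefficient has a FIRST unit coefficient. [cite: Washington1997, §7.1] -/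
theorem exists_firstUnitCoeffAt_of_isUnit_coeff {F : UnrSeries p} {i : ℕ} (hi : IsUnit (coeff i F)) :
    ∃ m, FirstUnitCoeffAt F m := by
  obtain ⟨m, -, hm⟩ := X1.KellerYinHalves.exists_firstUnitCoeffAt_of_exists_le (G := F) (N := i)
    ⟨i, le_rfl, by rw [(unrIntegers.isUnit_iff_norm_eq_one _).mp hi]; exact lt_irrefl 1⟩
  exact ⟨m, hm⟩

/-- **Identity principle along the powers of a principal unit**: an `R₀`-series whose values at all
`u^k − 1` (`k ≥ 1`) vanish is `0` (the points `u^{p^j} − 1 → 0` are non-zero). [cite: Washington1997, §7.1 Thm. 7.3] -/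
theorem eq_zero_of_tsum_eq_zero {F : UnrSeries p} {u : ℂ_[p]} (hu : ‖u - 1‖ < 1)
    (hu' : ∀ j : ℕ, u ^ p ^ j ≠ 1)
    (h : ∀ k : ℕ, 1 ≤ k → ∑' n, ((coeff n F : unrIntegers p) : ℂ_[p]) * (u ^ k - 1) ^ n = 0) :
    F = 0 := by
  have hT : Tendsto (fun j : ℕ ↦ u ^ p ^ j - 1) atTop (𝓝 0) := by
    have := (tendsto_pow_prime_pow_padicComplex hu).sub_const 1
    simpa using this
  refine unrSeries_eq_of_hasValueAt (v := fun _ ↦ (0 : ℂ_[p])) hT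
    (Frequently.of_forall fun j ↦ sub_ne_zero.mpr (hu' j)) (fun j ↦ ?_) (fun j ↦ ?_)
  · have hx : ‖u ^ p ^ j - 1‖ < 1 := lt_of_le_of_lt (R1.norm_pow_sub_one_le hu _) hu
    have hv := hasValueAt_tsum F hx
    rwa [h (p ^ j) (Nat.one_le_pow _ _ hp.out.pos)] at hv
  · show HasSum _ _
    simp

/-- **Multiples of a series with coefficients in `𝔪_{R₀}` have coefficients in `𝔪_{R₀}`** (norm `< 1`):
each coefficient of `A·D` is a finite sum of products `A_j·D_l` of norm `< 1` (ultrametric). [folklore] -/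
theorem norm_coe_coeff_mul_lt_one (A D : UnrSeries p)
    (hD : ∀ i : ℕ, ‖((coeff i D : unrIntegers p) : ℂ_[p])‖ < 1) (i : ℕ) :
    ‖((coeff i (A * D) : unrIntegers p) : ℂ_[p])‖ < 1 := by
  rw [X1.KellerYinHalves.coe_coeff_mul]
  have hne : (Finset.HasAntidiagonal.antidiagonal i).Nonempty :=
    ⟨(0, i), Finset.HasAntidiagonal.mem_antidiagonal.mpr (zero_add i)⟩
  obtain ⟨x, -, hle⟩ := IsUltrametricDist.exists_norm_finsetSum_le_of_nonempty hne
    (fun x : ℕ × ℕ ↦ ((coeff x.1 A : unrIntegers p) : ℂ_[p]) * ((coeff x.2 D : unrIntegers p) : ℂ_[p]))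
  refine hle.trans_lt ?_
  rw [norm_mul]
  calc ‖((coeff x.1 A : unrIntegers p) : ℂ_[p])‖ * ‖((coeff x.2 D : unrIntegers p) : ℂ_[p])‖
      ≤ 1 * ‖((coeff x.2 D : unrIntegers p) : ℂ_[p])‖ :=
        mul_le_mul_of_nonneg_right (norm_coe_unrIntegers_le_one p _) (norm_nonneg _)
    _ < 1 := by rw [one_mul]; exact hD x.2

end Bookkeeping

/-! ### §4 The structural lemma for a series with `μ = 0`, read back in `R₀⟦T⟧`; the `(1+T)^b`-twist in `R₀⟦T⟧` -/

section Structure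

/-- **The value relation for a series with `μ = 0` forces the structural form** (the ODE road of
`KatzLineDescentStructure`, read back in `R₀⟦T⟧`): if `Q` has its first unit coefficient at `m` and
`Q(u^k − 1) = d^k · M(u^k − 1)` for all `k ≥ 1`, then `M = c·(1+T)^b·Q` in `ℂ_p⟦T⟧` with `‖c‖ = 1`,
`b ∈ ℤ_p`, and `M` has its first unit coefficient at `m` as well. [cite: Washington1997, §7.1 Prop. 7.2, §7.2 Thm. 7.3]
[cite: Cassels1986, Ch. 4 Thm. 4.1, Ch. 6 §5] -/
theorem exists_eq_of_relation_of_firstUnitCoeffAt {Q M : UnrSeries p} {m : ℕ} (hm : FirstUnitCoeffAt Q m)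
    {u d : ℂ_[p]} (hu : ‖u - 1‖ < 1) (hu' : ∀ j : ℕ, u ^ p ^ j ≠ 1)
    (hrel : ∀ k : ℕ, 1 ≤ k →
      ∑' n, ((coeff n Q : unrIntegers p) : ℂ_[p]) * (u ^ k - 1) ^ n =
        d ^ k * ∑' n, ((coeff n M : unrIntegers p) : ℂ_[p]) * (u ^ k - 1) ^ n) :
    (∃ (c : ℂ_[p]) (b : ℤ_[p]), ‖c‖ = 1 ∧
      M.map (unrIntegers p).subtype =
        C c * ((PowerSeries.binomialSeries ℤ_[p] b).map (toUnr p)).map (unrIntegers p).subtype *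
          Q.map (unrIntegers p).subtype) ∧
    FirstUnitCoeffAt M m := by
  have hQ1 := norm_coeff_map_subtype_le (p := p) Q
  have hM1 := norm_coeff_map_subtype_le (p := p) M
  have hm' : ‖coeff m (Q.map (unrIntegers p).subtype)‖ = 1 ∧
      ∀ i < m, ‖coeff i (Q.map (unrIntegers p).subtype)‖ < 1 := by
    refine ⟨?_, fun i hi ↦ ?_⟩
    · rw [coeff_map_subtype]; exact hm.1
    · rw [coeff_map_subtype]; exact hm.2 i hi
  have hrel' : ∀ k : ℕ, 1 ≤ k →
      ∑' n, coeff n (Q.map (unrIntegers p).subtype) * (u ^ k - 1) ^ n =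
        d ^ k * ∑' n, coeff n (M.map (unrIntegers p).subtype) * (u ^ k - 1) ^ n := by
    intro k hk
    simp_rw [coeff_map_subtype]
    exact hrel k hk
  obtain ⟨c, b, hc, hMeq⟩ :=
    KatzLineDescent.exists_eq_C_mul_binomialSeries_map_mul_of_relation hQ1 hM1 hm' hu hu' hrel'
  have hfu := KatzLineDescent.firstUnit_of_relation hQ1 hM1 hm' hu hu' hrel'
  refine ⟨⟨c, b, hc, ?_⟩, ⟨?_, fun i hi ↦ ?_⟩⟩
  · rw [map_subtype_binomialSeries_map_toUnr]; exact hMeq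
  · have h1 := hfu.1; rwa [coeff_map_subtype] at h1
  · have h2 := hfu.2 i hi; rwa [coeff_map_subtype] at h2

/-- The `(1+T)^b`-twist in `R₀⟦T⟧` has first unit coefficient at `0` (constant term `1`). [folklore] -/
theorem firstUnitCoeffAt_binomialSeries_zero (b : ℤ_[p]) :
    FirstUnitCoeffAt ((PowerSeries.binomialSeries ℤ_[p] b).map (toUnr p)) 0 := by
  refine ⟨?_, fun i hi ↦ (Nat.not_lt_zero i hi).elim⟩
  rw [coeff_map, PowerSeries.binomialSeries_coeff, Ring.choose_zero_right, one_smul, map_one,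
    OneMemClass.coe_one, norm_one]

/-- The `(1+T)^b`-twist in `R₀⟦T⟧` is a unit. [folklore] -/
theorem isUnit_binomialSeries_map_toUnr (b : ℤ_[p]) :
    IsUnit ((PowerSeries.binomialSeries ℤ_[p] b).map (toUnr p)) := by
  refine IsUnit.of_mul_eq_one ((PowerSeries.binomialSeries ℤ_[p] (-b)).map (toUnr p)) ?_
  rw [← map_mul, ← PowerSeries.binomialSeries_add, add_neg_cancel, PowerSeries.binomialSeries_zero, map_one]

end Structure

end Summit.BirchSwinnertonDyer.BirchSwinnertonDyer.Theorems.GoodLatticeKatzFrameRigidity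

end
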